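import Summits.NavierStokesRegularity.NavierStokesRegularity.Theorems.ScenarioCensusSteady
import Summits.NavierStokesRegularity.NavierStokesRegularity.Theorems.ScenarioCensusPeriodicSlabSwirlLiouville
import Summits.NavierStokesRegularity.NavierStokesRegularity.Theorems.ScenarioCensusPeriodicSlabRadialLiouville
import Summits.NavierStokesRegularity.NavierStokesRegularity.Theorems.ScenarioCensusPeriodicSlabDecayLiouville
import HarnessLib

/-!
# Blow-up scenario census, block S: row S7 (Bang–Gui–Wang–Xie 2025, Thm 1.4) is
# EXCLUDED-IN-TREE — the named fact is discharged (leaf)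

Cell `pub/ns-census` (director-ns KEY req102, D-0154 (A)), typer seat `ns-census-typer-2` (generation 8).
Row S7 of the census (`ScenarioCensusSteady.lean`) is the composite Literature fact
`BangGuiWangXie2025_periodicSlab_liouville` (J. Fluid Mech. 1005 (2025) A6 = arXiv:2205.13259,
Thm 1.4: bounded smooth steady Navier–Stokes flows on `ℝ³`, axially `L`-periodic; (a) `u^θ`
independent of `θ` ∨ (b) `u^r` independent of `θ` ∨ (c) `r u^r → 0` ⇒ `U ≡ c e₃`; (d)
`sup ‖U‖ < 2πν/L` ⇒ constant). Cases (a), (b), (d) were proved in the tree by generations 6–7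
(`row_S7a_excluded`, `row_S7b_excluded`, `row_S7d_excluded`); this leaf adds case (c)
(`PeriodicSlab.periodicSlab_liouville_radialDecay`, `ScenarioCensusPeriodicSlabDecayLiouville.lean`:
the S6 chain plus the stream-function corrector `Ψ = Φ̃ J∇φ` replacing the printed Bogovskiĭ map)
and assembles the four cases into the fact itself:

* `Row_S7c` / `row_S7c_excluded` — case (c) VERBATIM the fact's binders with the third disjunct;
* `bangGuiWangXie2025_periodicSlab_liouville_holds` — the named fact, now a theorem of the tree;
* `row_S7_excluded : Row_S7` — the census row BY NAME.

No summit statement is proved; the census value of row S7 is the lead's call.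
-/

-- the summit and its single problem share the name (D-0017 nested layout)
set_option linter.dupNamespace false

noncomputable section

namespace Summit.NavierStokesRegularity.NavierStokesRegularity.Theorems.ScenarioCensus

open Literature.Analysis

/-- Census sub-row S7c — (steady · NO symmetry, instead RADIAL DECAY `r u^r → 0` uniformly as
`r → ∞` (`∀ ε > 0 ∃ R, |ρ(x) u_r(x)| ≤ ε` for `ρ(x) ≥ R`) · BOUNDED smooth steady solutions on
`ℝ³` (`IsLerayProfile ν 0 U P`, `U, P ∈ C^∞`, `∃ M, ∀ x, ‖U x‖ ≤ M`), any `ν > 0`, axially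
`L`-periodic for some `L > 0`): `U ≡ c e₃`. Case (c) of Bang–Gui–Wang–Xie 2025 Thm 1.4, verbatim
the binders of `Row_S7 = BangGuiWangXie2025_periodicSlab_liouville` with the third disjunct as
hypothesis (`row_S7c_of_row_S7`). -/
def Row_S7c : Prop :=
  ∀ ν : ℝ, 0 < ν → ∀ L : ℝ, 0 < L →
    ∀ (U : EuclideanSpace ℝ (Fin 3) → EuclideanSpace ℝ (Fin 3)) (P : EuclideanSpace ℝ (Fin 3) → ℝ),
      FluidPDE.IsLerayProfile ν 0 U P → ContDiff ℝ (⊤ : ℕ∞) U → ContDiff ℝ (⊤ : ℕ∞) P →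
      (∃ M : ℝ, ∀ x, ‖U x‖ ≤ M) → FluidPDE.IsAxiallyPeriodic L U →
        (∀ ε : ℝ, 0 < ε → ∃ R : ℝ, ∀ x, R ≤ FluidPDE.cylRadius x →
          |FluidPDE.cylRadius x * FluidPDE.radialVelocity U x| ≤ ε) →
          ∃ c : ℝ, U = fun _ => c • FluidPDE.eZ

/-- S7 ⇒ S7c (the third disjunct of the first conjunct of the printed theorem). -/
theorem row_S7c_of_row_S7 (h : Row_S7) : Row_S7c :=
  fun ν hν L hL U P hUP hU hP hbdd hper hdec =>
    (h ν hν L hL U P hUP hU hP hbdd hper).1 (Or.inr (Or.inr hdec))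

/-- **Census sub-row S7c is EXCLUDED-IN-TREE**: Bang–Gui–Wang–Xie 2025, Thm 1.4 (c), by
`PeriodicSlab.periodicSlab_liouville_radialDecay`. -/
theorem row_S7c_excluded : Row_S7c :=
  fun _ν hν _L hL _U _P hUP hU hP hbdd hper hdec =>
    PeriodicSlab.periodicSlab_liouville_radialDecay hν hL hUP hU hP hbdd hper hdec

/-- **Bang–Gui–Wang–Xie 2025, Thm 1.4, is a theorem of the tree**: the named fact
`Literature.Analysis.FluidPDE.BangGuiWangXie2025_periodicSlab_liouville` holds — cases (a)
`PeriodicSlab.periodicSlab_liouville_swirlAxisymmetric`, (b) `…_radialAxisymmetric`, (c)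
`…_radialDecay`, (d) `…periodicSlab_liouville_small`. -/
theorem bangGuiWangXie2025_periodicSlab_liouville_holds :
    FluidPDE.BangGuiWangXie2025_periodicSlab_liouville := by
  intro ν hν L hL U P hUP hU hP hbdd hper
  refine ⟨fun hcase => ?_, fun hsmall => PeriodicSlab.periodicSlab_liouville_small hν hL hUP hU hP hsmall hper⟩
  rcases hcase with hsw | hrad | hdec
  · exact PeriodicSlab.periodicSlab_liouville_swirlAxisymmetric hν hL hUP hU hP hbdd hper hsw
  · exact PeriodicSlab.periodicSlab_liouville_radialAxisymmetric hν hL hUP hU hP hbdd hper hrad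
  · exact PeriodicSlab.periodicSlab_liouville_radialDecay hν hL hUP hU hP hbdd hper hdec

/-- **Census row S7 is EXCLUDED-IN-TREE**: `Row_S7` (= the named fact
`BangGuiWangXie2025_periodicSlab_liouville`, BY NAME) holds. -/
theorem row_S7_excluded : Row_S7 :=
  bangGuiWangXie2025_periodicSlab_liouville_holds

end Summit.NavierStokesRegularity.NavierStokesRegularity.Theorems.ScenarioCensus

end
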